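import Mathlib
import Summits.NavierStokesRegularity.NavierStokesRegularity.Theorems.WakeRatchetTailRatchetDSS
import HarnessLib

/-!
# `WakeRatchet.TailRatchet` (stmt-NavierStokesRegularity-21808) on the DSS stratum, VISCOUS form:
# the tail ratchet forbids block-self-similar bounded eternal solutions at every viscosity level

Support lemmas (helper) extending `WakeRatchetTailRatchetDSS` (ν̂ = 0) to every covariant viscosity
`ν̂ ≥ 0`: `TailRatchet` quantifies over `IsEternalVisc ε₀ ν̂ α W` for all `ν̂`, and the block-self-similar
tail identity `Σ_k E_{n+p+k}(σ) = ϱ Σ_k E_{n+k}(σ − T)` with the contraction argument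
(`tail_shift`, `tail_le_pow_from`, `TailEnvelopeFinite.main`) never used `ν̂ = 0`.  Consequence
(`no_blockDSS_visc_of_tailRatchet`): below a threshold `ε₁(R)` no E₂(R) table carries a non-zero uniformly
bounded admissible eternal solution of ANY viscosity level that is block-self-similar with a positive lag —
in particular no exact type-I discretely self-similar viscous front (for `ν̂ > 0` the covariance of the
dissipation coefficient `ν̂(1+ε₀)^{2k}e^{-σ}` pins the lag of a shell-period-`p` front to `T = 2p log(1+ε₀)`,
block energy ratio `(1+ε₀)^{-p}`); so the parent route's «fixed-seed clock box» kill criterion for K1ᵛ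
(a Toda-pump DSS front at fixed seed as `ε₀ → 0`, rewritten in log-time) is a kill criterion for this crux.
MODEL lattice ODEs only (Tao 2016 §4, §6.4); nothing here concerns the Navier–Stokes equations.
-/

noncomputable section

set_option linter.dupNamespace false

namespace Summit.NavierStokesRegularity.NavierStokesRegularity.Theorems

namespace WakeRatchetDSS

open Filter Topology
open Literature.Analysis.FluidPDE Literature.Analysis.FluidPDE.TaoCascade
open WakeRatchetTail

variable {m : ℕ} {ε₀ : ℝ} {W : ℤ → ℝ → Em m}

/-! ## The exclusion at EVERY viscosity level `ν̂ ≥ 0`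

`TailRatchet` binds every covariant viscosity `ν̂ ≥ 0` (`IsEternalVisc`), and the block-self-similar tail
identity / contraction argument above never used `ν̂ = 0`.  Hence `TailRatchet` also forbids, below the same
threshold, every uniformly bounded admissible VISCOUS block-self-similar solution with a positive lag — in
particular every exact type-I discretely self-similar viscous front (for `ν̂ > 0` the covariance of the
dissipation coefficient `ν̂ (1+ε₀)^{2k} e^{-σ}` pins the lag of a shell-period-`p` front to `T = 2p·log(1+ε₀)`,
energy ratio `(1+ε₀)^{-p}` per block: the parent route's «fixed-seed clock box» kill criterion for K1ᵛ is
thereby a kill criterion for this crux too, see the companion `Negative/` file). -/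

/-- Viscous form of `ratio_le_of_contraction`: for a uniformly bounded admissible eternal solution with ANY
covariant viscosity `ν̂ ≥ 0` that is block-self-similar and whose tail envelopes contract by `1 − w` per
shell, `ϱ = e^{2T}Λ^{-2p} ≤ (1 − w)^p` as soon as some shell value is non-zero.
[cite: Tao2016AveragedNS, §4 Lemma 4.1 (4.8)–(4.10) with the viscous equation before Thm. 4.2, §6.4; cell vocabulary] -/
theorem ratio_le_of_contraction_visc (hε : 0 < ε₀) {νh : ℝ}
    {α : Fin m → Fin m → Fin m → ℤ × ℤ × ℤ → ℝ}
    (hc : IsCancellingCoeff α) (hW : IsEternalVisc ε₀ νh α W) (hU : UniformBound W) {p : ℕ} {T w : ℝ}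
    (hD : ∀ (n : ℤ) (σ : ℝ), W (n + p) σ = W n (σ - T))
    (hContr : ∀ (n : ℤ) (M : ℝ), (∀ σ : ℝ, ∑' k : ℕ, physEnergy ε₀ W (n + k) σ ≤ M) →
      ∀ σ : ℝ, ∑' k : ℕ, physEnergy ε₀ W (n + 1 + k) σ ≤ (1 - w) * M)
    {n₀ : ℤ} {σ₀ : ℝ} (hne : W n₀ σ₀ ≠ 0) :
    Real.exp (2 * T) * (bigLam ε₀ ^ p)⁻¹ ^ 2 ≤ (1 - w) ^ p := by
  set ϱ : ℝ := Real.exp (2 * T) * (bigLam ε₀ ^ p)⁻¹ ^ 2 with hϱ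
  set Θ : ℝ → ℝ := fun σ => ∑' k : ℕ, physEnergy ε₀ W (n₀ + k) σ with hΘ
  obtain ⟨M, hM⟩ := TailEnvelopeFinite.main hε hc hW hU n₀
  have hbdd : BddAbove (Set.range Θ) := ⟨M, by rintro _ ⟨σ, rfl⟩; exact hM σ⟩
  set S : ℝ := ⨆ σ, Θ σ with hS
  have hle : ∀ σ, Θ σ ≤ S := fun σ => le_ciSup hbdd σ
  have hSpos : 0 < S :=
    lt_of_lt_of_le (lt_of_lt_of_le (physEnergy_pos_of_ne hε hne) (physEnergy_le_tail hε hU n₀ σ₀))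
      (hle σ₀)
  have hp := tail_le_pow_from (w := w) hle hContr p
  have hρ0 : 0 ≤ ϱ := (blockRatio_pos hε p T).le
  have hall : ∀ σ, ϱ * Θ σ ≤ (1 - w) ^ p * S := by
    intro σ
    have h1 := hp (σ + T)
    rw [tail_shift hε hD n₀ (σ + T), add_sub_cancel_right] at h1
    exact h1
  have hmul : ϱ * S ≤ (1 - w) ^ p * S := by
    rw [hS, Real.mul_iSup_of_nonneg hρ0]
    exact ciSup_le hall
  exact le_of_mul_le_mul_right hmul hSpos

/-- Viscous form of `trivial_of_contraction`: below the threshold `(1+ε₀)^5 (1 − w) ≤ 1` (`w ≤ 1`), a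
uniformly bounded admissible eternal solution with ANY covariant viscosity `ν̂ ≥ 0` that is
block-self-similar with a positive lag and whose tail envelopes contract by `1 − w` per shell vanishes.
[cite: Tao2016AveragedNS, §4 Lemma 4.1 (4.8)–(4.10) with the viscous equation before Thm. 4.2, §6.4; cell vocabulary] -/
theorem trivial_of_contraction_visc (hε : 0 < ε₀) {νh : ℝ}
    {α : Fin m → Fin m → Fin m → ℤ × ℤ × ℤ → ℝ}
    (hc : IsCancellingCoeff α) (hW : IsEternalVisc ε₀ νh α W) (hU : UniformBound W) {p : ℕ} {T w : ℝ}
    (hT : 0 < T) (hw1 : w ≤ 1) (hthr : (1 + ε₀) ^ 5 * (1 - w) ≤ 1)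
    (hD : ∀ (n : ℤ) (σ : ℝ), W (n + p) σ = W n (σ - T))
    (hContr : ∀ (n : ℤ) (M : ℝ), (∀ σ : ℝ, ∑' k : ℕ, physEnergy ε₀ W (n + k) σ ≤ M) →
      ∀ σ : ℝ, ∑' k : ℕ, physEnergy ε₀ W (n + 1 + k) σ ≤ (1 - w) * M) :
    ∀ (n : ℤ) (σ : ℝ), W n σ = 0 := by
  intro n σ
  by_contra hne
  have h1 := ratio_le_of_contraction_visc hε hc hW hU hD hContr hne
  have h2 := inv_sq_lt_blockRatio hε p hT
  have hq : 0 < (1 + ε₀) ^ 5 := by positivity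
  have h3 : 1 - w ≤ ((1 + ε₀) ^ 5)⁻¹ := by
    rw [← one_div, le_div_iff₀ hq, mul_comm]
    exact hthr
  have h4 : (1 - w) ^ p ≤ (bigLam ε₀ ^ p)⁻¹ ^ 2 := by
    rw [inv_bigLam_pow_sq hε.le]
    exact pow_le_pow_left₀ (by linarith) h3 p
  linarith

/-- The threshold data of `TailRatchet` at spread `R`, at EVERY viscosity level: a rate `w ∈ (0, 1/2]`, a
scale threshold `ε₁ > 0` with `(1+ε₀)^5(1−w) ≤ 1` on `(0, ε₁]`, and the per-shell contraction at rate `w` for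
every bounded admissible eternal solution with covariant viscosity `ν̂ ≥ 0` of every E₂(R) table.
[cite: Tao2016AveragedNS, §4 Thm. 4.2 (statement shape) and the viscous equation before it, §6.4; cell vocabulary] -/
theorem threshold_visc_of_tailRatchet
    (h : Summit.NavierStokesRegularity.NavierStokesRegularity.Theses.WakeRatchet.TailRatchet)
    {R : ℝ} (hR : 1 ≤ R) :
    ∃ w : ℝ, 0 < w ∧ w ≤ 1 ∧ ∃ ε₁ : ℝ, 0 < ε₁ ∧ ∀ ε₀ : ℝ, 0 < ε₀ → ε₀ ≤ ε₁ →
      (1 + ε₀) ^ 5 * (1 - w) ≤ 1 ∧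
      ∀ α : Fin 4 → Fin 4 → Fin 4 → ℤ × ℤ × ℤ → ℝ, InTableClass R α →
        ∀ (νh : ℝ) (W : ℤ → ℝ → Em 4), IsEternalVisc ε₀ νh α W → UniformBound W →
          ∀ (n : ℤ) (M : ℝ), (∀ σ : ℝ, ∑' k : ℕ, physEnergy ε₀ W (n + k) σ ≤ M) →
            ∀ σ : ℝ, ∑' k : ℕ, physEnergy ε₀ W (n + 1 + k) σ ≤ (1 - w) * M := by
  obtain ⟨w, hw, εs, hεs, H⟩ := h R hR
  refine ⟨min w (1 / 2), lt_min hw (by norm_num), (min_le_right _ _).trans (by norm_num),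
    min εs (min w (1 / 2) / 5), lt_min hεs (by positivity), ?_⟩
  intro ε₀ hε₀ hle
  refine ⟨pow_five_mul_sub_le_one ((min_le_right _ _).trans (by norm_num)) hε₀.le
    (hle.trans (min_le_right _ _)), ?_⟩
  intro α hα νh W hW hU n M hM σ
  have hM0 : 0 ≤ M :=
    (tsum_nonneg fun k : ℕ => physEnergy_nonneg ε₀ W (n + (k : ℤ)) σ).trans (hM σ)
  have h1 := H ε₀ hε₀ (hle.trans (min_le_left _ _)) α hα νh W hW hU n M hM σ
  exact h1.trans (mul_le_mul_of_nonneg_right (by linarith [min_le_left w (1 / 2)]) hM0)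

/-- **`TailRatchet` ⟹ no block-self-similar bounded eternal solution of ANY viscosity level below
threshold.**  For every spread `R ≥ 1` there is `ε₁ > 0` such that for `ε₀ ∈ (0, ε₁]` no E₂(R) table carries
a non-zero uniformly bounded admissible eternal solution with covariant viscosity `ν̂ ≥ 0`
(`IsEternalVisc`) that is block-self-similar (`W_{n+p}(σ) = W_n(σ − T)`) with a POSITIVE lag — in
particular no exact type-I discretely self-similar viscous front («Toda pump at fixed seed» shape).
[cite: Tao2016AveragedNS, §4 Thm. 4.2 (statement shape) and the viscous equation before it, Lemma 4.1 (4.8)–(4.10), §6.4; cell vocabulary] -/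
theorem no_blockDSS_visc_of_tailRatchet
    (h : Summit.NavierStokesRegularity.NavierStokesRegularity.Theses.WakeRatchet.TailRatchet) :
    ∀ R : ℝ, 1 ≤ R → ∃ ε₁ : ℝ, 0 < ε₁ ∧ ∀ ε₀ : ℝ, 0 < ε₀ → ε₀ ≤ ε₁ →
      ∀ α : Fin 4 → Fin 4 → Fin 4 → ℤ × ℤ × ℤ → ℝ, InTableClass R α →
        ∀ (νh : ℝ) (W : ℤ → ℝ → Em 4) (p : ℕ) (T : ℝ), 0 < T → IsEternalVisc ε₀ νh α W →
          UniformBound W → (∀ (n : ℤ) (σ : ℝ), W (n + p) σ = W n (σ - T)) →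
            ∀ (n : ℤ) (σ : ℝ), W n σ = 0 := by
  intro R hR
  obtain ⟨w, _hw, hw1, ε₁, hε₁, H⟩ := threshold_visc_of_tailRatchet h hR
  refine ⟨ε₁, hε₁, fun ε₀ hε₀ hle α hα νh W p T hT hW hU hD => ?_⟩
  obtain ⟨hthr, Hc⟩ := H ε₀ hε₀ hle
  exact trivial_of_contraction_visc hε₀ hα.2.1 hW hU hT hw1 hthr hD (Hc α hα νh W hW hU)


/-- **Kill criterion at every viscosity level.**  Non-zero uniformly bounded admissible eternal solutions
with covariant viscosity `ν̂ ≥ 0` that are block-self-similar with a positive lag, on E₂(R) tables at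
arbitrarily small scale ratios, refute `TailRatchet` (e.g. a type-I DSS viscous front persisting at FIXED
spread as `ε₀ → 0`). [cite: Tao2016AveragedNS, §4; cell vocabulary] -/
theorem tailRatchet_false_of_persistent_blockDSS_visc {R : ℝ} (hR : 1 ≤ R)
    (hF : ∀ ε : ℝ, 0 < ε → ∃ ε₀ : ℝ, 0 < ε₀ ∧ ε₀ ≤ ε ∧
      ∃ α : Fin 4 → Fin 4 → Fin 4 → ℤ × ℤ × ℤ → ℝ, InTableClass R α ∧
        ∃ (νh : ℝ) (W : ℤ → ℝ → Em 4) (p : ℕ) (T : ℝ), 0 < T ∧ IsEternalVisc ε₀ νh α W ∧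
          UniformBound W ∧ (∀ (n : ℤ) (σ : ℝ), W (n + p) σ = W n (σ - T)) ∧ ∃ n σ, W n σ ≠ 0) :
    ¬ Summit.NavierStokesRegularity.NavierStokesRegularity.Theses.WakeRatchet.TailRatchet := by
  intro h
  obtain ⟨ε₁, hε₁, H⟩ := no_blockDSS_visc_of_tailRatchet h R hR
  obtain ⟨ε₀, hε₀, hle, α, hα, νh, W, p, T, hT, hW, hU, hD, n, σ, hne⟩ := hF ε₁ hε₁
  exact hne (H ε₀ hε₀ hle α hα νh W p T hT hW hU hD n σ)

/-! ## The RATE form of the ratchet pins the block ratio to the rate (repair analysis) -/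

/-- **Under a RATE ratchet the block ratio cannot beat the rate.**  If the tail envelopes of a non-trivial
uniformly bounded admissible eternal solution (any `ν̂ ≥ 0`) that is block-self-similar
(`W_{n+p}(σ) = W_n(σ − T)`) contract per shell by the rate `(1+ε₀)^{-a}` — the conclusion of the repaired
crux «rate ratchet» for this solution — then `ϱ = e^{2T}Λ^{-2p} ≤ (1+ε₀)^{-ap}`.  (So a rate ratchet with
exponent `a` is refuted by persistent fronts whose block ratio exceeds `(1+ε₀)^{-ap}`; Kolmogorov fronts have
`ϱ = (1+ε₀)^{-5p/3}`, whence the recommended window `1 < a < 5/3`.)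
[cite: Tao2016AveragedNS, §4 Lemma 4.1 (4.8)–(4.10), §6.4; cell vocabulary] -/
theorem blockRatio_le_of_rateContraction (hε : 0 < ε₀) {νh : ℝ}
    {α : Fin m → Fin m → Fin m → ℤ × ℤ × ℤ → ℝ}
    (hc : IsCancellingCoeff α) (hW : IsEternalVisc ε₀ νh α W) (hU : UniformBound W) {p : ℕ} {T a : ℝ}
    (hD : ∀ (n : ℤ) (σ : ℝ), W (n + p) σ = W n (σ - T))
    (hRate : ∀ (n : ℤ) (M : ℝ), (∀ σ : ℝ, ∑' k : ℕ, physEnergy ε₀ W (n + k) σ ≤ M) →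
      ∀ σ : ℝ, ∑' k : ℕ, physEnergy ε₀ W (n + 1 + k) σ ≤ (1 + ε₀) ^ (-a) * M)
    {n₀ : ℤ} {σ₀ : ℝ} (hne : W n₀ σ₀ ≠ 0) :
    Real.exp (2 * T) * (bigLam ε₀ ^ p)⁻¹ ^ 2 ≤ ((1 + ε₀) ^ (-a)) ^ p := by
  have hContr : ∀ (n : ℤ) (M : ℝ), (∀ σ : ℝ, ∑' k : ℕ, physEnergy ε₀ W (n + k) σ ≤ M) →
      ∀ σ : ℝ, ∑' k : ℕ, physEnergy ε₀ W (n + 1 + k) σ ≤ (1 - (1 - (1 + ε₀) ^ (-a))) * M := by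
    intro n M hM σ
    rw [sub_sub_cancel]
    exact hRate n M hM σ
  have h := ratio_le_of_contraction_visc hε hc hW hU hD hContr hne
  rwa [sub_sub_cancel] at h

/-- **Kill criterion for a rate ratchet with exponent `a`** (the repaired crux, quoted as the negated
statement): uniformly bounded admissible non-trivial block-self-similar eternal solutions (any `ν̂ ≥ 0`,
shell period `p`, positive or not lag `T`) on E₂(R) tables at arbitrarily small scale ratios whose block
ratio EXCEEDS the rate, `e^{2T}Λ^{-2p} > (1+ε₀)^{-ap}`, refute it.  With Kolmogorov fronts
(`e^{2T}Λ^{-2p} = (1+ε₀)^{-5p/3}`, the dyadic member) this bites exactly when `a > 5/3`.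
[cite: Tao2016AveragedNS, §4; cell vocabulary] -/
theorem not_rateRatchet_of_persistent_fast_fronts {R a : ℝ}
    (hF : ∀ ε : ℝ, 0 < ε → ∃ ε₀ : ℝ, 0 < ε₀ ∧ ε₀ ≤ ε ∧
      ∃ α : Fin 4 → Fin 4 → Fin 4 → ℤ × ℤ × ℤ → ℝ, InTableClass R α ∧
        ∃ (νh : ℝ) (W : ℤ → ℝ → Em 4) (p : ℕ) (T : ℝ), IsEternalVisc ε₀ νh α W ∧ UniformBound W ∧
          (∀ (n : ℤ) (σ : ℝ), W (n + p) σ = W n (σ - T)) ∧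
          ((1 + ε₀) ^ (-a)) ^ p < Real.exp (2 * T) * (bigLam ε₀ ^ p)⁻¹ ^ 2 ∧ ∃ n σ, W n σ ≠ 0) :
    ¬ (∃ εs : ℝ, 0 < εs ∧ ∀ ε₀ : ℝ, 0 < ε₀ → ε₀ ≤ εs →
      ∀ α : Fin 4 → Fin 4 → Fin 4 → ℤ × ℤ × ℤ → ℝ, InTableClass R α →
        ∀ (νh : ℝ) (W : ℤ → ℝ → Em 4), IsEternalVisc ε₀ νh α W → UniformBound W →
          ∀ (n : ℤ) (M : ℝ), (∀ σ : ℝ, ∑' k : ℕ, physEnergy ε₀ W (n + k) σ ≤ M) →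
            ∀ σ : ℝ, ∑' k : ℕ, physEnergy ε₀ W (n + 1 + k) σ ≤ (1 + ε₀) ^ (-a) * M) := by
  rintro ⟨εs, hεs, H⟩
  obtain ⟨ε₀, hε₀, hle, α, hα, νh, W, p, T, hW, hU, hD, hfast, n, σ, hne⟩ := hF εs hεs
  have h := blockRatio_le_of_rateContraction hε₀ hα.2.1 hW hU hD (H ε₀ hε₀ hle α hα νh W hW hU) hne
  linarith


end WakeRatchetDSS

end Summit.NavierStokesRegularity.NavierStokesRegularity.Theorems

end
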